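import Summits.MatrixMultiplication.MatrixMultiplication.Theorems.SoloInformedValPairPacking

/-!
# SoloInformedValNestedPacking — a dominated star and ALL `JK`-labels fit into `G` together

Solo-informed programme (MatrixMultiplication, side question on the value of trapezoid-free triples), gen 79.

Setting (as in `SoloInformedValInducedMatching`, `SoloInformedValVertexDegree`, `SoloInformedValPairPacking`): an
abelian group `G`, potentials `x : I → G`, `y : J → G`, `z : K → G`, pair graphs `H_IJ, H_JK, H_KI`, and the
hypothesis `NoAccidental`.  Write `t_i` for the number of triangles through `i`, and
`B = {y j - z k : (j, k) ∈ H_JK}` for the set of ALL `JK`-labels.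

## Results

* `NoAccidental.card_star_add_card_labelsJK_le` — NESTED PACKING, `J`-side: if `i ≠ i₀` and every triangle of a
  finite set `S` of triangles through `i` has its `J`-vertex `H_IJ`-adjacent to `i₀`, then `|S| + |B| ≤ |G|`.
* `NoAccidental.card_star_add_card_labelsJK_le'` — the same conclusion when every triangle of `S` has its
  `K`-vertex `H_KI`-adjacent to `i₀`.
* `NoAccidental.degree_add_card_labelsJK_le` — in particular, if `i₀` dominates `i` in `H_IJ`
  (`(i, j) ∈ H_IJ → (i₀, j) ∈ H_IJ`), then `t_i + |B| ≤ |G|`.  Since the link of `i₀` injects into the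
  triangle-supporting `JK`-edges and those inject into `B` (`NoAccidental.edgeJK_eq_of_label_eq`), this contains
  PAIR PACKING `t_i + t_{i₀} ≤ |G|` for dominated pairs and is strictly stronger whenever some labelled `JK`-edge
  is not completed by `i₀`.  For a vertex `i₀` adjacent to ALL of `J` (a `J`-universal hub) it gives
  `t_i ≤ |G| - |B|` for every other `I`-vertex `i`.
* `pb_nested_tight` — tightness at the two-row block in `(ℤ/2)⁴` of `SoloInformedValPairPacking`:
  `t_1 + |B| = 8 + 8 = 16 = |G|`.

## Proof

Shift every label of the star of `i` by `x i - x i₀`.  Shifted labels are pairwise distinct (a `JK`-label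
determines its edge, and an edge together with `i` determines the triangle) and none of them is a label:
`y j - z k + (x i - x i₀) = y j' - z k'` with `(i₀, j) ∈ H_IJ`, `(j', k') ∈ H_JK`, `(k, i) ∈ H_KI` is exactly the
situation excluded by `NoAccidental.shifted_label_ne`.  So the `|S|` shifted labels and the `|B|` labels are
`|S| + |B|` distinct elements of `G`.  The `K`-side version shifts by `x i₀ - x i` and uses the edges
`(i, j) ∈ H_IJ`, `(k, i₀) ∈ H_KI` instead.
-/

namespace Summit.MatrixMultiplication.MatrixMultiplication.Theorems.SoloVal

variable {G : Type*} [AddCommGroup G]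
variable {I J K : Type*}
variable {x : I → G} {y : J → G} {z : K → G}
variable {HIJ : Finset (I × J)} {HJK : Finset (J × K)} {HKI : Finset (K × I)}

/-- NESTED PACKING (`J`-side).  `i ≠ i₀`; `S` a finite set of triangles through `i` each of whose `J`-vertices
is `H_IJ`-adjacent to `i₀`.  Then `|S| + |{y j - z k : (j, k) ∈ H_JK}| ≤ |G|`. -/
theorem NoAccidental.card_star_add_card_labelsJK_le [Fintype G] [DecidableEq G] [DecidableEq J]
    [DecidableEq K] (hN : NoAccidental x y z HIJ HJK HKI) {i₀ i : I} (hne : i₀ ≠ i)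
    {S : Finset (I × J × K)} (hS : ∀ τ ∈ S, IsTriangle HIJ HJK HKI τ ∧ τ.1 = i ∧ (i₀, τ.2.1) ∈ HIJ) :
    S.card + (HJK.image (fun e : J × K => y e.1 - z e.2)).card ≤ Fintype.card G := by
  have hinj : Set.InjOn (fun τ : I × J × K => y τ.2.1 - z τ.2.2 + (x i - x i₀)) ↑S := by
    rintro ⟨a, j, k⟩ hτ ⟨a', j', k'⟩ hτ' heq
    obtain ⟨ht, ha, -⟩ := hS _ (Finset.mem_coe.mp hτ)
    obtain ⟨ht', ha', -⟩ := hS _ (Finset.mem_coe.mp hτ')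
    simp only at heq ha ha'
    have hl : y j - z k = y j' - z k' := add_right_cancel heq
    have h2 := hN.edgeJK_eq_of_label_eq ht ht' hl
    simp only [Prod.mk.injEq] at h2
    rw [ha, ha', h2.1, h2.2]
  have hdisj : Disjoint (S.image (fun τ : I × J × K => y τ.2.1 - z τ.2.2 + (x i - x i₀)))
      (HJK.image (fun e : J × K => y e.1 - z e.2)) := by
    rw [Finset.disjoint_left]
    intro g hg hg'
    obtain ⟨⟨a, j, k⟩, hτ, hgτ⟩ := Finset.mem_image.mp hg
    obtain ⟨⟨j', k'⟩, he, hge⟩ := Finset.mem_image.mp hg'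
    obtain ⟨⟨-, -, ht3⟩, ha, h1⟩ := hS _ hτ
    simp only at ht3 ha h1 hgτ hge
    rw [ha] at ht3
    exact hN.shifted_label_ne hne h1 ht3 he (hgτ.trans hge.symm)
  calc S.card + (HJK.image (fun e : J × K => y e.1 - z e.2)).card
      = (S.image (fun τ : I × J × K => y τ.2.1 - z τ.2.2 + (x i - x i₀))).card
          + (HJK.image (fun e : J × K => y e.1 - z e.2)).card := by
        rw [Finset.card_image_of_injOn hinj]
    _ = (S.image (fun τ : I × J × K => y τ.2.1 - z τ.2.2 + (x i - x i₀))
          ∪ HJK.image (fun e : J × K => y e.1 - z e.2)).card :=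
        (Finset.card_union_of_disjoint hdisj).symm
    _ ≤ Fintype.card G := Finset.card_le_univ _

/-- NESTED PACKING (`K`-side).  `i ≠ i₀`; `S` a finite set of triangles through `i` each of whose `K`-vertices
is `H_KI`-adjacent to `i₀`.  Then `|S| + |{y j - z k : (j, k) ∈ H_JK}| ≤ |G|`. -/
theorem NoAccidental.card_star_add_card_labelsJK_le' [Fintype G] [DecidableEq G] [DecidableEq J]
    [DecidableEq K] (hN : NoAccidental x y z HIJ HJK HKI) {i₀ i : I} (hne : i ≠ i₀)
    {S : Finset (I × J × K)} (hS : ∀ τ ∈ S, IsTriangle HIJ HJK HKI τ ∧ τ.1 = i ∧ (τ.2.2, i₀) ∈ HKI) :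
    S.card + (HJK.image (fun e : J × K => y e.1 - z e.2)).card ≤ Fintype.card G := by
  have hinj : Set.InjOn (fun τ : I × J × K => y τ.2.1 - z τ.2.2 + (x i₀ - x i)) ↑S := by
    rintro ⟨a, j, k⟩ hτ ⟨a', j', k'⟩ hτ' heq
    obtain ⟨ht, ha, -⟩ := hS _ (Finset.mem_coe.mp hτ)
    obtain ⟨ht', ha', -⟩ := hS _ (Finset.mem_coe.mp hτ')
    simp only at heq ha ha'
    have hl : y j - z k = y j' - z k' := add_right_cancel heq
    have h2 := hN.edgeJK_eq_of_label_eq ht ht' hl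
    simp only [Prod.mk.injEq] at h2
    rw [ha, ha', h2.1, h2.2]
  have hdisj : Disjoint (S.image (fun τ : I × J × K => y τ.2.1 - z τ.2.2 + (x i₀ - x i)))
      (HJK.image (fun e : J × K => y e.1 - z e.2)) := by
    rw [Finset.disjoint_left]
    intro g hg hg'
    obtain ⟨⟨a, j, k⟩, hτ, hgτ⟩ := Finset.mem_image.mp hg
    obtain ⟨⟨j', k'⟩, he, hge⟩ := Finset.mem_image.mp hg'
    obtain ⟨⟨ht1, -, -⟩, ha, h3⟩ := hS _ hτ
    simp only at ht1 ha h3 hgτ hge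
    rw [ha] at ht1
    exact hN.shifted_label_ne hne ht1 h3 he (hgτ.trans hge.symm)
  calc S.card + (HJK.image (fun e : J × K => y e.1 - z e.2)).card
      = (S.image (fun τ : I × J × K => y τ.2.1 - z τ.2.2 + (x i₀ - x i))).card
          + (HJK.image (fun e : J × K => y e.1 - z e.2)).card := by
        rw [Finset.card_image_of_injOn hinj]
    _ = (S.image (fun τ : I × J × K => y τ.2.1 - z τ.2.2 + (x i₀ - x i))
          ∪ HJK.image (fun e : J × K => y e.1 - z e.2)).card :=
        (Finset.card_union_of_disjoint hdisj).symm
    _ ≤ Fintype.card G := Finset.card_le_univ _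

/-- `t_i + |B| ≤ |G|` when `i₀ ≠ i` dominates `i` in `H_IJ`: every `H_IJ`-neighbour of `i` is an
`H_IJ`-neighbour of `i₀` (for instance `i₀` is adjacent to all of `J`).  Here `t_i` is the number of triangles
through `i` and `B` the set of all `JK`-labels. -/
theorem NoAccidental.degree_add_card_labelsJK_le [Fintype G] [DecidableEq G] [DecidableEq I] [DecidableEq J]
    [DecidableEq K] (hN : NoAccidental x y z HIJ HJK HKI) {i₀ i : I} (hne : i₀ ≠ i)
    (hdom : ∀ j, (i, j) ∈ HIJ → (i₀, j) ∈ HIJ) :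
    ((triangleSet HIJ HJK HKI).filter (fun τ => τ.1 = i)).card
      + (HJK.image (fun e : J × K => y e.1 - z e.2)).card ≤ Fintype.card G := by
  refine hN.card_star_add_card_labelsJK_le hne ?_
  intro τ hτ
  rw [Finset.mem_filter, mem_triangleSet] at hτ
  obtain ⟨ht, hi⟩ := hτ
  refine ⟨ht, hi, hdom _ ?_⟩
  rw [← hi]
  exact ht.1

/-- The triangle-supporting `JK`-edges inject into the label set `B`: the number of `JK`-edges lying in at
least one triangle of a finite set `T` of triangles is at most `|B|`.  (With `T` = the link of `i₀` this turns
`NoAccidental.degree_add_card_labelsJK_le` into pair packing for dominated pairs.) -/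
theorem NoAccidental.card_edgesJK_le_card_labels [DecidableEq G] [DecidableEq J] [DecidableEq K]
    (hN : NoAccidental x y z HIJ HJK HKI) {T : Finset (I × J × K)}
    (hT : ∀ τ ∈ T, IsTriangle HIJ HJK HKI τ) :
    (T.image (fun τ : I × J × K => τ.2)).card ≤ (HJK.image (fun e : J × K => y e.1 - z e.2)).card := by
  have hsub : (T.image (fun τ : I × J × K => τ.2)).image (fun e : J × K => y e.1 - z e.2)
      ⊆ HJK.image (fun e : J × K => y e.1 - z e.2) := by
    intro g hg
    obtain ⟨e, he, rfl⟩ := Finset.mem_image.mp hg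
    obtain ⟨τ, hτ, rfl⟩ := Finset.mem_image.mp he
    exact Finset.mem_image.mpr ⟨τ.2, (hT τ hτ).2.1, rfl⟩
  have hinj : Set.InjOn (fun e : J × K => y e.1 - z e.2) ↑(T.image (fun τ : I × J × K => τ.2)) := by
    intro e he e' he' heq
    obtain ⟨τ, hτ, rfl⟩ := Finset.mem_image.mp (Finset.mem_coe.mp he)
    obtain ⟨τ', hτ', rfl⟩ := Finset.mem_image.mp (Finset.mem_coe.mp he')
    exact hN.edgeJK_eq_of_label_eq (hT τ hτ) (hT τ' hτ') heq
  calc (T.image (fun τ : I × J × K => τ.2)).card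
      = ((T.image (fun τ : I × J × K => τ.2)).image (fun e : J × K => y e.1 - z e.2)).card :=
        (Finset.card_image_of_injOn hinj).symm
    _ ≤ (HJK.image (fun e : J × K => y e.1 - z e.2)).card := Finset.card_le_card hsub

/-- TIGHTNESS of nested packing at the two-row block in `(ℤ/2)⁴` (`SoloInformedValPairPacking.pb*`): the
vertex `1` carries `8` triangles and there are `8` distinct `JK`-labels, `8 + 8 = 16 = |G|`. -/
theorem pb_nested_tight :
    ((triangleSet (Finset.univ : Finset (Fin 2 × Fin 2)) (Finset.univ : Finset (Fin 2 × Fin 4))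
        (Finset.univ : Finset (Fin 4 × Fin 2))).filter (fun τ => τ.1 = 1)).card
      + ((Finset.univ : Finset (Fin 2 × Fin 4)).image (fun e : Fin 2 × Fin 4 => pbY e.1 - pbZ e.2)).card
      = Fintype.card G16 := by
  rw [card_G16]
  decide

end Summit.MatrixMultiplication.MatrixMultiplication.Theorems.SoloVal
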